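import Mathlib
import HarnessLib
import Summits.HubbardSuperconductivity.HubbardSuperconductivity.Theorems.KLProgrammeKLRegimeSplitBornOddnessKernel
import Summits.HubbardSuperconductivity.HubbardSuperconductivity.Theorems.KLProgrammeMatsubaraRiemannSum
import Summits.HubbardSuperconductivity.HubbardSuperconductivity.Theorems.KLProgrammeRadialMassSharp

/-!
# Route `KLProgramme` — ENGINE (stmt-HubbardSuperconductivity-20437 `KLRegimeEngineV17F2`), row (c) binder #8 (v19 `hexLadMV`'s VALUE rows `RP RQ`), cure of located #23
# «(c)-IN-PH-BELOW-RESOLUTION», brick O6a: THE PARTICLE–HOLE ROTATION LEMMA, PLANAR FORM — the zero-transfer p-h bubble with a RADIAL slice weight,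
# Matsubara-summed and integrated over the scale tube of the frame band, is THERMAL `∝ (π/β)/Λ` + DOS-SLOPE `∝ jacR·Λ` sized, not `∝ 1/Λ`
# (cell gate-hubbard-kl, seat hubbard-kl-k3c2-p2 g31, technique «thermal-bar induction n ≤ nScales β + 1 with EngineBoundsAtV4S sums»)

WHY.  Located #23 (k3c1-p1 g26): binder #8's p-h rows in `M4² × MASS` form charge the zero-transfer one-slice p-h insertion at the flat size `Σ_p|Ẇĝ||Φĝ| ≍ 1/Λ`
(× `Λd` = n-flat in the budget), with no home below the p-h plateau.  Its VALUE is smaller: with `G = klWd·klPhi` radial, the frequency sum at fixed momentum is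
`Σ_ν G ĝ_K(ν,k̃)² = Σ_ν G(s_ν)(e_K² − ω_ν²)/s_ν²` (✓ `klod_sum_even_mul_propCT_sq`) — the `cos 2φ` harmonic of the `(ω, e)` plane — and
`f(ω, e) := G(ω² + e²)·(e² − ω²)/(ω² + e²)²` is ANTISYMMETRIC under the swap `(ω, e) ↦ (e, ω)`, so its planar integral VANISHES.  What survives on the model
carrier is (i) the Matsubara midpoint-rule error (`klmr_matsubara_sum_sub_integral_norm_le`: thermal, `∝ (r₂ + 2π/β)/β`) times the level density at the Fermi
level, and (ii) the variation of the level density across the shell (`abs_levelDensity_sub_le`: `|N_K(ρ) − N_K(0)| ≤ 2π·jacR·|ρ|`, DOS-slope).  This file is the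
PLANAR statement (momentum integral over the tube of the open square in the C4a chart, frequency sum discrete); the lattice step (`klfl_*`, `32Λ K/L`) is O6b.

* §1 `klph_f_*` — the integrand `f`: bound `|f| ≤ M_G/r₁²`, support (`|ω| < r₂`, `|e| < r₂`), swap antisymmetry, `ω`-Lipschitz `2r₂·L⋆` uniformly in `e`
  (`L⋆ = 2r₂²(ℓ/r₁⁴ + 2M_G/r₁⁶) + ℓ/r₁² + M_G/r₁⁴`, via `klrm_radial_lipschitz_fst` on the `e`-dependent profile `s ↦ G(s)(2e² − s)/s²`), continuity, planar integral `= 0`;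
* §2 `klph_integral_tube_levelFn_eq` — for a bounded measurable level function `φ`: `∫_{tube} φ(e_K(q)) dq = ∫_{(−r,r)} N_K(ρ)·φ(ρ) dρ` (C4a chart + Fubini; the general form of
  O3 part 3's `volume_openSq_levelSet_eq_integral_levelDensity`);
* §3 **`klph_planar_rotation_le`** — under the C4a chart hypotheses, `r₂ ≤ r`, `0 < β`, `βr₂/(2π) + 1 ≤ M`:
  `|β⁻¹ Σ_i ∫_{q ∈ (−π,π)², |e_K(q)| < r} f(ω_i, e_K(q)) dq| ≤ N₀·(2r₂·(2r₂L⋆))·(r₂ + 2π/β)/β + (r₂/π + 1/β)·4π·jacR·r₂²·M_G/r₁²`, `N₀ = N_K(0) ≤ 2π·π√2/(Dt_min − 2A)` —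
  the first term is `thermalBar`-sized, the second `frameShiftBar`-sized, once multiplied by the budget's `Λd` (located #23 §3's homes, now a theorem in planar form).
Pure analysis on the tree's objects; no definitions; nothing asserts (c), K3 or superconductivity.
References: BGM 2006 §2.4 (2.40)–(2.41), §2.5 [cite: BenfattoGiulianiMastropietro2006]; midpoint rule [folklore].
-/

noncomputable section

namespace Summit.HubbardSuperconductivity.HubbardSuperconductivity.Theorems.KLRegimeSplit

set_option linter.dupNamespace false -- summit = problem name (single-conjunct summit), D-0017

open Real Set Finset MeasureTheory Literature.MathematicalPhysics.QuantumLattice Literature.Probability.LatticeModels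
open Literature.MathematicalPhysics.QuantumLattice.BandSectorCounting
open Summit.HubbardSuperconductivity.HubbardSuperconductivity.Theorems.TwoPointAssembly
open Summit.HubbardSuperconductivity.HubbardSuperconductivity.Theorems.EngineV8
open Summit.HubbardSuperconductivity.HubbardSuperconductivity.Theorems.DispersionFlow
open Summit.HubbardSuperconductivity.HubbardSuperconductivity.Theorems.PerturbedFermiCurve
open Summit.HubbardSuperconductivity.HubbardSuperconductivity.Theorems.C4a

/-! ## §1 The integrand `f(ω, e) = G(ω² + e²)·(e² − ω²)/(ω² + e²)²` -/

section Integrand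

variable {G : ℝ → ℝ} {Mg ℓ r₁ r₂ : ℝ}

/-- `f` in terms of the `e`-dependent radial profile: `f(ω,e) = G(s)(2e² − s)/s²`, `s = ω² + e²`. -/
theorem klph_f_eq_profile (G : ℝ → ℝ) (ω e : ℝ) :
    G (ω ^ 2 + e ^ 2) * (e ^ 2 - ω ^ 2) / (ω ^ 2 + e ^ 2) ^ 2 =
      (fun s : ℝ => 2 * e ^ 2 * (G s / s ^ 2) - G s / s) (ω ^ 2 + e ^ 2) := by
  rcases eq_or_ne (ω ^ 2 + e ^ 2) 0 with h | h
  · simp [h]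
  · field_simp
    ring

/-- **Swap antisymmetry**: `f(e, ω) = −f(ω, e)`. -/
theorem klph_f_swap (G : ℝ → ℝ) (ω e : ℝ) :
    G (e ^ 2 + ω ^ 2) * (ω ^ 2 - e ^ 2) / (e ^ 2 + ω ^ 2) ^ 2 = -(G (ω ^ 2 + e ^ 2) * (e ^ 2 - ω ^ 2) / (ω ^ 2 + e ^ 2) ^ 2) := by
  rw [add_comm (e ^ 2) (ω ^ 2)]; ring

/-- `|f(ω,e)| ≤ |G(s)|/s ≤ M_G/r₁²` (`|e² − ω²| ≤ s`). -/
theorem klph_f_abs_le (hbd : ∀ s, |G s| ≤ Mg) (hin : ∀ s, s ≤ r₁ ^ 2 → G s = 0) (hr₁ : 0 < r₁) (ω e : ℝ) :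
    |G (ω ^ 2 + e ^ 2) * (e ^ 2 - ω ^ 2) / (ω ^ 2 + e ^ 2) ^ 2| ≤ Mg / r₁ ^ 2 := by
  have h1 := klok_div_abs_le hbd hin hr₁ (ω ^ 2 + e ^ 2)
  rcases eq_or_ne (ω ^ 2 + e ^ 2) 0 with h | h
  · rw [h]; simp; exact div_nonneg ((abs_nonneg _).trans (hbd 0)) (sq_nonneg _)
  · have hs : 0 < ω ^ 2 + e ^ 2 := lt_of_le_of_ne (by positivity) (Ne.symm h)
    have hratio : |(e ^ 2 - ω ^ 2) / (ω ^ 2 + e ^ 2)| ≤ 1 := by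
      rw [abs_div, abs_of_pos hs, div_le_one hs]
      exact (abs_sub _ _).trans (by rw [abs_of_nonneg (sq_nonneg e), abs_of_nonneg (sq_nonneg ω)]; linarith)
    calc |G (ω ^ 2 + e ^ 2) * (e ^ 2 - ω ^ 2) / (ω ^ 2 + e ^ 2) ^ 2|
        = |G (ω ^ 2 + e ^ 2) / (ω ^ 2 + e ^ 2)| * |(e ^ 2 - ω ^ 2) / (ω ^ 2 + e ^ 2)| := by
          rw [← abs_mul]; congr 1; field_simp
      _ ≤ Mg / r₁ ^ 2 * 1 := mul_le_mul h1 hratio (abs_nonneg _) (div_nonneg ((abs_nonneg _).trans (hbd 0)) (sq_nonneg _))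
      _ = Mg / r₁ ^ 2 := mul_one _

/-- `f(ω,e) = 0` for `|ω| ≥ r₂` (`G = 0` for `s ≥ r₂²`). -/
theorem klph_f_zero_of_freq (hout : ∀ s, r₂ ^ 2 ≤ s → G s = 0) (hr₂ : 0 ≤ r₂) {ω : ℝ} (hω : r₂ ≤ |ω|) (e : ℝ) :
    G (ω ^ 2 + e ^ 2) * (e ^ 2 - ω ^ 2) / (ω ^ 2 + e ^ 2) ^ 2 = 0 := by
  rw [hout _ (by nlinarith [sq_nonneg e, sq_abs ω, abs_nonneg ω]), zero_mul, zero_div]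

/-- `f(ω,e) = 0` for `|e| ≥ r₂`. -/
theorem klph_f_zero_of_level (hout : ∀ s, r₂ ^ 2 ≤ s → G s = 0) (hr₂ : 0 ≤ r₂) (ω : ℝ) {e : ℝ} (he : r₂ ≤ |e|) :
    G (ω ^ 2 + e ^ 2) * (e ^ 2 - ω ^ 2) / (ω ^ 2 + e ^ 2) ^ 2 = 0 := by
  rw [hout _ (by nlinarith [sq_nonneg ω, sq_abs e, abs_nonneg e]), zero_mul, zero_div]

/-- **`ω`-Lipschitz bound, uniformly in the level**: for `|e| ≤ r₂`,
`|f(ω,e) − f(ω′,e)| ≤ 2r₂·(2r₂²(ℓ/r₁⁴ + 2M_G/r₁⁶) + ℓ/r₁² + M_G/r₁⁴)·|ω − ω′|` (the `e`-dependent profile `s ↦ G(s)(2e² − s)/s²` is Lipschitz by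
`klok_div(Sq)_lipschitz`, and `klrm_radial_lipschitz_fst` turns it into an `ω`-Lipschitz bound through the clamped radius). -/
theorem klph_f_lipschitz_freq (hbd : ∀ s, |G s| ≤ Mg) (hlip : ∀ s s', |G s - G s'| ≤ ℓ * |s - s'|) (hin : ∀ s, s ≤ r₁ ^ 2 → G s = 0)
    (hout : ∀ s, r₂ ^ 2 ≤ s → G s = 0) (hr₁ : 0 < r₁) (hr₂ : 0 ≤ r₂) {e : ℝ} (he : |e| ≤ r₂) (ω ω' : ℝ) :
    |G (ω ^ 2 + e ^ 2) * (e ^ 2 - ω ^ 2) / (ω ^ 2 + e ^ 2) ^ 2 - G (ω' ^ 2 + e ^ 2) * (e ^ 2 - ω' ^ 2) / (ω' ^ 2 + e ^ 2) ^ 2| ≤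
      2 * r₂ * (2 * r₂ ^ 2 * (ℓ / r₁ ^ 4 + 2 * Mg / r₁ ^ 6) + (ℓ / r₁ ^ 2 + Mg / r₁ ^ 4)) * |ω - ω'| := by
  have hMg : 0 ≤ Mg := (abs_nonneg _).trans (hbd 0)
  have hℓ : 0 ≤ ℓ := by
    have h := hlip 0 1; have h0 : 0 ≤ |G 0 - G 1| := abs_nonneg _; norm_num at h; linarith
  have he2 : e ^ 2 ≤ r₂ ^ 2 := by nlinarith [abs_nonneg e, sq_abs e]
  -- the profile `N_e(s) = 2e²·G(s)/s² − G(s)/s` is Lipschitz with constant `2e²·L₂ + L₁ ≤ 2r₂²·L₂ + L₁`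
  have hN : ∀ s s', |(2 * e ^ 2 * (G s / s ^ 2) - G s / s) - (2 * e ^ 2 * (G s' / s' ^ 2) - G s' / s')| ≤
      (2 * r₂ ^ 2 * (ℓ / r₁ ^ 4 + 2 * Mg / r₁ ^ 6) + (ℓ / r₁ ^ 2 + Mg / r₁ ^ 4)) * |s - s'| := by
    intro s s'
    have h1 := klok_divSq_lipschitz hbd hlip hin hr₁ s s'
    have h2 := klok_div_lipschitz hbd hlip hin hr₁ s s'
    calc |(2 * e ^ 2 * (G s / s ^ 2) - G s / s) - (2 * e ^ 2 * (G s' / s' ^ 2) - G s' / s')|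
        = |2 * e ^ 2 * (G s / s ^ 2 - G s' / s' ^ 2) - (G s / s - G s' / s')| := by ring_nf
      _ ≤ 2 * e ^ 2 * |G s / s ^ 2 - G s' / s' ^ 2| + |G s / s - G s' / s'| := by
          refine (abs_sub _ _).trans ?_
          rw [abs_mul, abs_of_nonneg (by positivity : (0:ℝ) ≤ 2 * e ^ 2)]
      _ ≤ 2 * r₂ ^ 2 * ((ℓ / r₁ ^ 4 + 2 * Mg / r₁ ^ 6) * |s - s'|) + (ℓ / r₁ ^ 2 + Mg / r₁ ^ 4) * |s - s'| := by
          gcongr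
      _ = _ := by ring
  have hNout : ∀ s, r₂ ^ 2 ≤ s → (2 * e ^ 2 * (G s / s ^ 2) - G s / s) = 0 := fun s hs => by simp [hout s hs]
  have hL : 0 ≤ 2 * r₂ ^ 2 * (ℓ / r₁ ^ 4 + 2 * Mg / r₁ ^ 6) + (ℓ / r₁ ^ 2 + Mg / r₁ ^ 4) := by positivity
  have h := klrm_radial_lipschitz_fst (N := fun s => 2 * e ^ 2 * (G s / s ^ 2) - G s / s) hN hL hNout hr₂ e ω ω'
  rw [klph_f_eq_profile G ω e, klph_f_eq_profile G ω' e]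
  beta_reduce at h ⊢
  exact h

/-- `f` is continuous on the plane (the profile `s ↦ G(s)/s²` is Lipschitz, hence continuous). -/
theorem klph_f_continuous (hbd : ∀ s, |G s| ≤ Mg) (hlip : ∀ s s', |G s - G s'| ≤ ℓ * |s - s'|) (hin : ∀ s, s ≤ r₁ ^ 2 → G s = 0)
    (hr₁ : 0 < r₁) :
    Continuous fun p : ℝ × ℝ => G (p.1 ^ 2 + p.2 ^ 2) * (p.2 ^ 2 - p.1 ^ 2) / (p.1 ^ 2 + p.2 ^ 2) ^ 2 := by
  have hMg : 0 ≤ Mg := (abs_nonneg _).trans (hbd 0)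
  have hℓ : 0 ≤ ℓ := by
    have h := hlip 0 1; have h0 : 0 ≤ |G 0 - G 1| := abs_nonneg _; norm_num at h; linarith
  have hq : Continuous fun s : ℝ => G s / s ^ 2 :=
    klrm_continuous_of_lipschitz (klok_divSq_lipschitz hbd hlip hin hr₁) (by positivity)
  have heq : (fun p : ℝ × ℝ => G (p.1 ^ 2 + p.2 ^ 2) * (p.2 ^ 2 - p.1 ^ 2) / (p.1 ^ 2 + p.2 ^ 2) ^ 2) =
      fun p : ℝ × ℝ => (fun s : ℝ => G s / s ^ 2) (p.1 ^ 2 + p.2 ^ 2) * (p.2 ^ 2 - p.1 ^ 2) := by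
    funext p; simp only; ring
  rw [heq]
  exact (hq.comp (by continuity)).mul (by continuity)

/-- `f` is integrable on the plane (continuous, supported in the closed sup-ball of radius `r₂`). -/
theorem klph_f_integrable (hbd : ∀ s, |G s| ≤ Mg) (hlip : ∀ s s', |G s - G s'| ≤ ℓ * |s - s'|) (hin : ∀ s, s ≤ r₁ ^ 2 → G s = 0)
    (hout : ∀ s, r₂ ^ 2 ≤ s → G s = 0) (hr₁ : 0 < r₁) (hr₂ : 0 ≤ r₂) :
    Integrable fun p : ℝ × ℝ => G (p.1 ^ 2 + p.2 ^ 2) * (p.2 ^ 2 - p.1 ^ 2) / (p.1 ^ 2 + p.2 ^ 2) ^ 2 := by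
  refine (klph_f_continuous hbd hlip hin hr₁).integrable_of_hasCompactSupport ?_
  refine HasCompactSupport.intro (isCompact_closedBall (0 : ℝ × ℝ) r₂) fun p hp => ?_
  rw [Metric.mem_closedBall, dist_zero_right, Prod.norm_def, not_le] at hp
  simp only [Real.norm_eq_abs] at hp
  rcases lt_max_iff.mp hp with h1 | h1
  · exact klph_f_zero_of_freq hout hr₂ h1.le _
  · exact klph_f_zero_of_level hout hr₂ _ h1.le

/-- **THE ROTATION**: `∫∫ f(ω, e) dω de = 0` (swap antisymmetry; Lebesgue measure on the plane is swap-invariant). -/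
theorem klph_integral_plane_eq_zero (G : ℝ → ℝ) :
    ∫ p : ℝ × ℝ, G (p.1 ^ 2 + p.2 ^ 2) * (p.2 ^ 2 - p.1 ^ 2) / (p.1 ^ 2 + p.2 ^ 2) ^ 2 = 0 := by
  have h := integral_prod_swap (μ := (volume : Measure ℝ)) (ν := (volume : Measure ℝ))
    (fun p : ℝ × ℝ => G (p.1 ^ 2 + p.2 ^ 2) * (p.2 ^ 2 - p.1 ^ 2) / (p.1 ^ 2 + p.2 ^ 2) ^ 2)
  rw [← Measure.volume_eq_prod] at h
  simp only [Prod.fst_swap, Prod.snd_swap] at h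
  have h2 : ∫ p : ℝ × ℝ, G (p.2 ^ 2 + p.1 ^ 2) * (p.1 ^ 2 - p.2 ^ 2) / (p.2 ^ 2 + p.1 ^ 2) ^ 2 =
      -∫ p : ℝ × ℝ, G (p.1 ^ 2 + p.2 ^ 2) * (p.2 ^ 2 - p.1 ^ 2) / (p.1 ^ 2 + p.2 ^ 2) ^ 2 := by
    rw [← integral_neg]
    exact integral_congr_ae (Filter.Eventually.of_forall fun p => klph_f_swap G p.1 p.2)
  linarith

end Integrand

/-! ## §2 Level functions over the tube in chart coordinates -/

section Chart

variable {a b : ℝ} (B : BandBounds a b) {K : TrigPolyC4v} {A : ℝ}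
  (hA : ∀ p : Momentum, ∀ j ≤ 2, ‖iteratedFDeriv ℝ j (frameShift K) p‖ ≤ A) (hADt : 2 * A < B.Dtmin)
  {μ r : ℝ} (hlo : a < μ - r - A) (hhi : μ + r + A < b)
include B hA hADt hlo hhi

/-- **A bounded measurable function of the level, integrated over the tube, in level coordinates**:
`∫_{|q₁|,|q₂| < π, |e_K(q)| < r} φ(e_K(q)) dq = ∫_{ρ ∈ (−r,r)} N_K(ρ)·φ(ρ) dρ`, `N_K(ρ) = ∫_{(0,2π]} J(ρ,ϑ) dϑ`. [cite: BenfattoGiulianiMastropietro2006, §2.4 (2.40)] -/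
theorem klph_integral_tube_levelFn_eq (φ : ℝ → ℝ) (hφm : Measurable φ) {C : ℝ} (hφb : ∀ x, |φ x| ≤ C) :
    ∫ q in {q : ℝ × ℝ | |q.1| < π ∧ |q.2| < π ∧ |frameLevel μ K (WithLp.toLp 2 ![q.1, q.2])| < r}, φ (frameLevel μ K (WithLp.toLp 2 ![q.1, q.2])) =
      ∫ ρ in Ioo (-r) r, (∫ ϑ in Ioc 0 (2 * π), levelChartJac μ K (ρ, ϑ)) * φ ρ := by
  have hπ := Real.pi_pos
  rw [setIntegral_tube_eq_chart B hA hADt hlo hhi]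
  have hbox : ∀ p ∈ Ioo (-r) r ×ˢ Ioc (-π) π,
      (perturbedFermiRadius (fun k : Fin 2 → ℝ => -K.eval k) (μ + p.1) p.2 *
          deriv (fun m : ℝ => perturbedFermiRadius (fun k : Fin 2 → ℝ => -K.eval k) m p.2) (μ + p.1)) •
        φ (frameLevel μ K (WithLp.toLp 2 ![(levelChart μ K p).1, (levelChart μ K p).2])) = levelChartJac μ K p * φ p.1 := by
    intro p hp
    have hp1 : p.1 ∈ Ioo (-r) r := (mem_prod.1 hp).1
    rw [smul_eq_mul, toLp_vec_levelChart, frameLevel_levelPoint B hA (by linarith [hp1.1]) (by linarith [hp1.2]), ← levelChartJac_apply]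
  rw [setIntegral_congr_fun (measurableSet_Ioo.prod measurableSet_Ioc) hbox]
  -- integrability of `J·φ∘fst` on every chart box
  have hKint : ∀ u v : ℝ, IntegrableOn (fun p : ℝ × ℝ => levelChartJac μ K p * φ p.1) (Ioo (-r) r ×ˢ Ioc u v) := by
    intro u v
    have hJ := integrableOn_levelChartJac_box B hA hADt hlo hhi (measurableSet_Ioo.prod measurableSet_Ioc) (subset_refl (Ioo (-r) r ×ˢ Ioc u v))
    refine Integrable.mul_of_top_left hJ ?_
    exact memLp_top_of_bound (hφm.comp measurable_fst).aestronglyMeasurable C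
      (Filter.Eventually.of_forall fun p => by rw [Real.norm_eq_abs]; exact hφb p.1)
  -- shift the angular window and apply Fubini
  have hper : ∀ ρ, Function.Periodic (fun ϑ => levelChartJac μ K (ρ, ϑ) * φ (ρ, ϑ).1) (2 * π) := by
    intro ρ ϑ; simp only [levelChartJac_periodic μ K ρ ϑ]
  rw [setIntegral_box_shift_angle hper (hKint _ _) (hKint _ _), Measure.volume_eq_prod, setIntegral_prod _ (by
    rw [← Measure.volume_eq_prod]; exact hKint _ _)]
  refine setIntegral_congr_fun measurableSet_Ioo fun ρ _ => ?_
  exact integral_mul_const (φ ρ) _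

/-! ## §3 THE PLANAR ROTATION LEMMA -/

/-- **THE PARTICLE–HOLE ROTATION LEMMA, PLANAR FORM.**  For a real slice weight `G` (`|G| ≤ M_G`, `ℓ`-Lipschitz, `G = 0` for `s ≤ r₁²` and `s ≥ r₂²`,
`0 < r₁`, `0 < r₂ < r`), `0 < β` and a Matsubara cutoff `βr₂/(2π) + 1 ≤ M`, under the C4a chart hypotheses:
`|β⁻¹ Σ_i ∫_{|q₁|,|q₂|<π, |e_K(q)|<r} G(ω_i² + e_K²)(e_K² − ω_i²)/(ω_i² + e_K²)² dq| ≤ N₀·(2r₂·(2r₂L⋆))·(r₂ + 2π/β)/β + β⁻¹·(r₂β/π + 1)·(2r₂)·(2π·jacR·r₂·(M_G/r₁²))`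
with `N₀ ≤ 2π·π√2/(Dt_min − 2A)` the level density at the Fermi level, `L⋆ = 2r₂²(ℓ/r₁⁴ + 2M_G/r₁⁶) + ℓ/r₁² + M_G/r₁⁴`,
`jacR = 1/(Dt_min − 2A)² + π√2(2 + 4A)/(Dt_min − 2A)³`.  The flat `1/Λ` size of the sign-blind mass is replaced by THERMAL + DOS-SLOPE sizes (located #23 §3).
[cite: BenfattoGiulianiMastropietro2006, §2.4–§2.5] -/
theorem klph_planar_rotation_le {M : ℕ} {β : ℝ} (hβ : 0 < β) {G : ℝ → ℝ} {Mg ℓ r₁ r₂ : ℝ} (hbd : ∀ s, |G s| ≤ Mg)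
    (hlip : ∀ s s', |G s - G s'| ≤ ℓ * |s - s'|) (hin : ∀ s, s ≤ r₁ ^ 2 → G s = 0) (hout : ∀ s, r₂ ^ 2 ≤ s → G s = 0)
    (hr₁ : 0 < r₁) (hr₂ : 0 < r₂) (hr₂r : r₂ < r) (hM : β * r₂ / (2 * Real.pi) + 1 ≤ M) :
    |β⁻¹ * ∑ i : MatsubaraIdx M, ∫ q in {q : ℝ × ℝ | |q.1| < π ∧ |q.2| < π ∧ |frameLevel μ K (WithLp.toLp 2 ![q.1, q.2])| < r},
        G (matsubaraFreq β M i ^ 2 + frameLevel μ K (WithLp.toLp 2 ![q.1, q.2]) ^ 2) *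
          (frameLevel μ K (WithLp.toLp 2 ![q.1, q.2]) ^ 2 - matsubaraFreq β M i ^ 2) /
            (matsubaraFreq β M i ^ 2 + frameLevel μ K (WithLp.toLp 2 ![q.1, q.2]) ^ 2) ^ 2| ≤
      2 * π * (π * Real.sqrt 2 / (B.Dtmin - 2 * A)) *
          ((2 * r₂ * (2 * r₂ * (2 * r₂ ^ 2 * (ℓ / r₁ ^ 4 + 2 * Mg / r₁ ^ 6) + (ℓ / r₁ ^ 2 + Mg / r₁ ^ 4)))) * (r₂ + 2 * Real.pi / β) / β) +
        β⁻¹ * ((r₂ * β / π + 1) * (2 * r₂ * (2 * π * (1 / (B.Dtmin - 2 * A) ^ 2 + Real.pi * Real.sqrt 2 * (2 + 4 * A) / (B.Dtmin - 2 * A) ^ 3) * r₂ *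
          (Mg / r₁ ^ 2)))) := by
  have hπ := Real.pi_pos
  have hr0 : 0 < r := hr₂.trans hr₂r
  have hMg : 0 ≤ Mg := (abs_nonneg _).trans (hbd 0)
  have hℓ : 0 ≤ ℓ := by
    have h := hlip 0 1; have h0 : 0 ≤ |G 0 - G 1| := abs_nonneg _; norm_num at h; linarith
  -- abbreviations: the integrand, the level density, the Lipschitz constant
  obtain ⟨f, hf⟩ : ∃ f : ℝ → ℝ → ℝ, ∀ ω e, f ω e = G (ω ^ 2 + e ^ 2) * (e ^ 2 - ω ^ 2) / (ω ^ 2 + e ^ 2) ^ 2 := ⟨_, fun _ _ => rfl⟩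
  obtain ⟨N, hN⟩ : ∃ N : ℝ → ℝ, ∀ ρ, N ρ = ∫ ϑ in Ioc 0 (2 * π), levelChartJac μ K (ρ, ϑ) := ⟨_, fun _ => rfl⟩
  set Ls : ℝ := 2 * r₂ ^ 2 * (ℓ / r₁ ^ 4 + 2 * Mg / r₁ ^ 6) + (ℓ / r₁ ^ 2 + Mg / r₁ ^ 4) with hLs
  set jacR : ℝ := 1 / (B.Dtmin - 2 * A) ^ 2 + Real.pi * Real.sqrt 2 * (2 + 4 * A) / (B.Dtmin - 2 * A) ^ 3 with hjacR
  have hLs0 : 0 ≤ Ls := by positivity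
  have hjac0 : 0 < jacR := by
    rw [hjacR]; exact jacRadialConst_pos B hADt (le_trans (norm_nonneg _) (hA 0 0 (by norm_num)))
  -- facts about `f`
  have hfb : ∀ ω e, |f ω e| ≤ Mg / r₁ ^ 2 := fun ω e => by rw [hf]; exact klph_f_abs_le hbd hin hr₁ ω e
  have hfω0 : ∀ ω, r₂ ≤ |ω| → ∀ e, f ω e = 0 := fun ω hω e => by rw [hf]; exact klph_f_zero_of_freq hout hr₂.le hω e
  have hfe0 : ∀ ω e, r₂ ≤ |e| → f ω e = 0 := fun ω e he => by rw [hf]; exact klph_f_zero_of_level hout hr₂.le ω he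
  have hflip : ∀ e ω ω', |f ω e - f ω' e| ≤ 2 * r₂ * Ls * |ω - ω'| := by
    intro e ω ω'
    rcases le_or_gt (|e|) r₂ with he | he
    · rw [hf, hf]; exact klph_f_lipschitz_freq hbd hlip hin hout hr₁ hr₂.le he ω ω'
    · rw [hfe0 ω e he.le, hfe0 ω' e he.le, sub_zero, abs_zero]; positivity
  have hfcont : Continuous fun p : ℝ × ℝ => f p.1 p.2 := by
    have := klph_f_continuous hbd hlip hin hr₁; refine this.congr fun p => ?_; simp only [hf]
  have hfint : Integrable fun p : ℝ × ℝ => f p.1 p.2 := by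
    have := klph_f_integrable hbd hlip hin hout hr₁ hr₂.le; refine this.congr (Filter.Eventually.of_forall fun p => ?_); simp only [hf]
  have hfibre : ∀ ω, Integrable fun e => f ω e := fun ω => by
    refine (hfcont.comp (continuous_const.prodMk continuous_id)).integrable_of_hasCompactSupport ?_
    exact HasCompactSupport.intro (isCompact_Icc (a := -r₂) (b := r₂)) fun e he => hfe0 ω e (klsp_le_abs_of_not_mem_Icc he)
  have hfmeas : ∀ ω, Measurable fun e => f ω e := fun ω => (hfcont.comp (continuous_const.prodMk continuous_id)).measurable
  -- the frequency function `F(ω) = ∫_{(−r,r)} f(ω,ρ) dρ = ∫ f(ω,ρ) dρ`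
  have hFeq : ∀ ω, ∫ ρ in Ioo (-r) r, f ω ρ = ∫ ρ, f ω ρ := fun ω =>
    setIntegral_eq_integral_of_forall_compl_eq_zero fun ρ hρ => hfe0 ω ρ (by
      by_contra h; exact hρ ⟨by linarith [(abs_lt.1 (not_le.1 h)).1], by linarith [(abs_lt.1 (not_le.1 h)).2]⟩)
  have hF0 : ∀ ω, r₂ ≤ |ω| → ∫ ρ, f ω ρ = 0 := fun ω hω => by simp only [hfω0 ω hω, integral_zero]
  have hFlip : ∀ ω ω', ‖(∫ ρ, f ω ρ) - ∫ ρ, f ω' ρ‖ ≤ 2 * r₂ * (2 * r₂ * Ls) * |ω - ω'| := by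
    intro ω ω'
    rw [← integral_sub (hfibre ω) (hfibre ω'), Real.norm_eq_abs,
      ← setIntegral_eq_integral_of_forall_compl_eq_zero (s := Icc (-r₂) r₂) (fun ρ hρ => by
        rw [hfe0 ω ρ (klsp_le_abs_of_not_mem_Icc hρ), hfe0 ω' ρ (klsp_le_abs_of_not_mem_Icc hρ), sub_zero])]
    have hvol : volume (Icc (-r₂) r₂) < ⊤ := by rw [Real.volume_Icc]; exact ENNReal.ofReal_lt_top
    have h := norm_setIntegral_le_of_norm_le_const hvol (f := fun ρ => f ω ρ - f ω' ρ) (C := 2 * r₂ * Ls * |ω - ω'|)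
      (fun ρ _ => by rw [Real.norm_eq_abs]; exact hflip ρ ω ω')
    rw [Real.norm_eq_abs, Real.volume_real_Icc_of_le (by linarith)] at h
    calc _ ≤ 2 * r₂ * Ls * |ω - ω'| * (r₂ - -r₂) := h
      _ = 2 * r₂ * (2 * r₂ * Ls) * |ω - ω'| := by ring
  have hFint : ∫ ω, ∫ ρ, f ω ρ = 0 := by
    rw [← integral_prod _ hfint]
    have := klph_integral_plane_eq_zero G
    rw [← this]
    exact integral_congr_ae (Filter.Eventually.of_forall fun p => by simp only [hf])
  -- the Matsubara midpoint rule on `F`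
  have hRiem := klmr_matsubara_sum_sub_integral_norm_le (E := ℝ) (g := fun ω => ∫ ρ, f ω ρ) (D := 2 * r₂ * (2 * r₂ * Ls)) (by positivity)
    hFlip hr₂.le hF0 hβ hM
  rw [hFint, smul_zero, sub_zero, smul_eq_mul, Real.norm_eq_abs] at hRiem
  -- per frequency: chart coordinates and the DOS split
  have hchart : ∀ i : MatsubaraIdx M,
      ∫ q in {q : ℝ × ℝ | |q.1| < π ∧ |q.2| < π ∧ |frameLevel μ K (WithLp.toLp 2 ![q.1, q.2])| < r},
        f (matsubaraFreq β M i) (frameLevel μ K (WithLp.toLp 2 ![q.1, q.2])) =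
      N 0 * (∫ ρ, f (matsubaraFreq β M i) ρ) + ∫ ρ in Ioo (-r) r, (N ρ - N 0) * f (matsubaraFreq β M i) ρ := by
    intro i
    rw [klph_integral_tube_levelFn_eq B hA hADt hlo hhi (f (matsubaraFreq β M i)) (hfmeas _) (hfb _), ← hFeq, ← integral_const_mul]
    simp_rw [← hN]
    rw [← integral_add]
    · exact setIntegral_congr_fun measurableSet_Ioo fun ρ _ => by ring
    · exact ((hfibre _).const_mul _).integrableOn
    · -- `(N − N0)·f` is bounded and measurable on the finite interval
      have hNc : ContinuousOn (fun ρ => (N ρ - N 0) * f (matsubaraFreq β M i) ρ) (Ioo (-r) r) := by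
        have hc := continuousOn_levelDensity B hA hADt hlo hhi
        refine ((hc.congr fun ρ _ => (hN ρ)).sub continuousOn_const).mul ?_
        exact (hfcont.comp (continuous_const.prodMk continuous_id)).continuousOn
      refine IntegrableOn.of_bound (by rw [Real.volume_Ioo]; exact ENNReal.ofReal_lt_top) (hNc.aestronglyMeasurable measurableSet_Ioo)
        ((2 * (2 * π * (π * Real.sqrt 2 / (B.Dtmin - 2 * A)))) * (Mg / r₁ ^ 2)) (ae_restrict_of_forall_mem measurableSet_Ioo fun ρ hρ => ?_)
      have h1 := levelDensity_nonneg_le B hA hADt hlo hhi hρ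
      have h0 := levelDensity_nonneg_le B hA hADt hlo hhi (ρ := 0) ⟨by linarith, hr0⟩
      rw [← hN] at h1 h0
      rw [Real.norm_eq_abs, abs_mul]
      refine mul_le_mul ?_ (hfb _ _) (abs_nonneg _) (by positivity)
      rw [abs_le]; constructor <;> linarith [h1.1, h1.2, h0.1, h0.2]
  -- the DOS-slope term per frequency
  have hslope : ∀ i : MatsubaraIdx M, |∫ ρ in Ioo (-r) r, (N ρ - N 0) * f (matsubaraFreq β M i) ρ| ≤ 2 * r₂ * (2 * π * jacR * r₂ * (Mg / r₁ ^ 2)) := by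
    intro i
    rw [setIntegral_eq_of_subset_of_forall_sdiff_eq_zero measurableSet_Ioo (Icc_subset_Ioo (by linarith) (by linarith) : Icc (-r₂) r₂ ⊆ Ioo (-r) r)
      (fun ρ hρ => by rw [hfe0 _ ρ (klsp_le_abs_of_not_mem_Icc hρ.2), mul_zero])]
    have hvol : volume (Icc (-r₂) r₂) < ⊤ := by rw [Real.volume_Icc]; exact ENNReal.ofReal_lt_top
    have h := norm_setIntegral_le_of_norm_le_const hvol (f := fun ρ => (N ρ - N 0) * f (matsubaraFreq β M i) ρ)
      (C := 2 * π * jacR * r₂ * (Mg / r₁ ^ 2)) (fun ρ hρ => by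
        have hρr : ρ ∈ Ioo (-r) r := ⟨by linarith [hρ.1], by linarith [hρ.2]⟩
        have hd := abs_levelDensity_sub_le B hA hADt hlo hhi hρr (ρ' := 0) ⟨by linarith, hr0⟩
        rw [← hN, ← hN, sub_zero] at hd
        rw [Real.norm_eq_abs, abs_mul]
        refine mul_le_mul (hd.trans ?_) (hfb _ _) (abs_nonneg _) (by positivity)
        have : |ρ| ≤ r₂ := abs_le.2 ⟨hρ.1, hρ.2⟩
        have hj : 0 ≤ 2 * π * jacR := by positivity
        nlinarith)
    rw [Real.norm_eq_abs, Real.volume_real_Icc_of_le (by linarith)] at h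
    calc _ ≤ 2 * π * jacR * r₂ * (Mg / r₁ ^ 2) * (r₂ - -r₂) := h
      _ = _ := by ring
  -- only frequencies `ω_i² < r₂²` contribute to the slope sum
  have hslope0 : ∀ i : MatsubaraIdx M, ¬ matsubaraFreq β M i ^ 2 < r₂ ^ 2 → ∫ ρ in Ioo (-r) r, (N ρ - N 0) * f (matsubaraFreq β M i) ρ = 0 := by
    intro i hi
    have hω : r₂ ≤ |matsubaraFreq β M i| := by
      have h := sq_le_sq.1 (not_lt.1 hi); rwa [abs_of_pos hr₂] at h
    simp only [hfω0 _ hω, mul_zero, integral_zero]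
  have hsum_slope : |∑ i : MatsubaraIdx M, ∫ ρ in Ioo (-r) r, (N ρ - N 0) * f (matsubaraFreq β M i) ρ| ≤
      (r₂ * β / π + 1) * (2 * r₂ * (2 * π * jacR * r₂ * (Mg / r₁ ^ 2))) := by
    rw [← sum_filter_of_ne (p := fun i => matsubaraFreq β M i ^ 2 < r₂ ^ 2) (fun i _ hne => by by_contra h; exact hne (hslope0 i h))]
    refine (abs_sum_le_sum_abs _ _).trans ((sum_le_sum fun i _ => hslope i).trans ?_)
    rw [sum_const, nsmul_eq_mul]
    exact mul_le_mul_of_nonneg_right (klok_card_freq_le hβ hr₂.le) (by positivity)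
  -- assemble
  have hN0 := levelDensity_nonneg_le B hA hADt hlo hhi (ρ := 0) ⟨by linarith, hr0⟩
  rw [← hN] at hN0
  have hmain : β⁻¹ * ∑ i : MatsubaraIdx M, ∫ q in {q : ℝ × ℝ | |q.1| < π ∧ |q.2| < π ∧ |frameLevel μ K (WithLp.toLp 2 ![q.1, q.2])| < r},
        f (matsubaraFreq β M i) (frameLevel μ K (WithLp.toLp 2 ![q.1, q.2])) =
      N 0 * (β⁻¹ * ∑ i : MatsubaraIdx M, ∫ ρ, f (matsubaraFreq β M i) ρ) +
        β⁻¹ * ∑ i : MatsubaraIdx M, ∫ ρ in Ioo (-r) r, (N ρ - N 0) * f (matsubaraFreq β M i) ρ := by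
    rw [Finset.sum_congr rfl fun i _ => hchart i, sum_add_distrib, ← mul_sum]; ring
  have hgoal : |β⁻¹ * ∑ i : MatsubaraIdx M, ∫ q in {q : ℝ × ℝ | |q.1| < π ∧ |q.2| < π ∧ |frameLevel μ K (WithLp.toLp 2 ![q.1, q.2])| < r},
        f (matsubaraFreq β M i) (frameLevel μ K (WithLp.toLp 2 ![q.1, q.2]))| ≤
      2 * π * (π * Real.sqrt 2 / (B.Dtmin - 2 * A)) * ((2 * r₂ * (2 * r₂ * Ls)) * (r₂ + 2 * Real.pi / β) / β) +
        β⁻¹ * ((r₂ * β / π + 1) * (2 * r₂ * (2 * π * jacR * r₂ * (Mg / r₁ ^ 2)))) := by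
    rw [hmain]
    refine (abs_add_le _ _).trans (add_le_add ?_ ?_)
    · rw [abs_mul, abs_of_nonneg hN0.1]
      exact mul_le_mul hN0.2 hRiem (abs_nonneg _) (by positivity)
    · rw [abs_mul, abs_of_pos (inv_pos.2 hβ)]
      exact mul_le_mul_of_nonneg_left hsum_slope (inv_pos.2 hβ).le
  simpa only [hf] using hgoal

end Chart

end Summit.HubbardSuperconductivity.HubbardSuperconductivity.Theorems.KLRegimeSplit

end
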